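import Literature.Computability.Cryptography.ShiftSamplingReadout
import Literature.Computability.Cryptography.ShiftSamplingUniform
import Literature.Computability.Cryptography.PeriodFindingTwoSamples
import HarnessLib

/-!
# Fourier sampling of a computed table, VI: the vector of all unit characters (family, uniformity, law)

Topic `Computability/Cryptography`; closes the series `ShiftSamplingBlock.lean` (the classical block of the
shift experiment for a polynomial-time table `tab x : ℕ → {0,1}*`), `ShiftSamplingFamily.lean` (the
family `P.family` and its read-out law `kernelProb_family`: independent units, each following Kitaev's
per-unit law `unitLaw`), `ShiftSamplingUniform.lean` (`family_isUniform`) and `ShiftSamplingReadout.lean`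
(the character `charOf n v u` of unit `u` read off the measured string, `codeFP_charOf`) with the ONE
statement a classical consumer of the experiment needs — the **character-vector form** of the shift
experiment (Kitaev 1995, §3 Thm 1: every unit's eigenvalue index is recovered exactly with probability
`≥ 1 − ηacc`; Jozsa 2003, §10 Thm. 6: "we obtain a value c … with probability …", for all units at once):

* `unitWeight_const` — with a constant block length `L` the weight of the character `c` is
  `corrMass_{2^L}(tab)(c) / (2^L)²`;
* `prob_cEstVec_ge` — under the product of the per-unit laws, the probability that Kitaev's estimates
  of ALL units are a given character vector `c⃗` is `≥ (1 − #U·ηacc) · ∏_u unitWeight_u (c_u)` (a product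
  event, `prob_piFinset`; per unit `unitLaw_cEst_ge`; Bernoulli `(1 − η)^{#U} ≥ 1 − #U η`);
* `prob_cEstVec_mem_ge` — summed over a set `G` of character vectors (the fibres are disjoint);
* **`charVector_family`** — for a parameter bundle `P` with counter expressions, unary-computable sizes
  and `Lv = L + 1` levels, and a polynomial-time table program `tab`: the family is uniform, the vector
  of the `nU` unit characters is read off the measured string by a function in `FP`, and for every set
  `G` of character vectors the read vector lies in `G` with probability
  `≥ (1 − nU·ηacc(Lv, B)) · ∑_{c⃗ ∈ G} ∏_u corrMass_{2^L}(tab z)(c_u) / (2^L)²`.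

Theorem file, no named facts, no number theory.

## References

* A. Yu. Kitaev, *Quantum measurements and the Abelian stabilizer problem*, arXiv:quant-ph/9511026
  (1995), §3 (Lemma 8, Lemma 10, Thm 1). [Kitaev1995]
* R. Jozsa, *Notes on Hallgren's efficient quantum algorithm for solving Pell's equation*,
  arXiv:quant-ph/0302134 (2003), §10 (Thm. 6 and its proof). [Jozsa2003]
-/

noncomputable section

namespace Literature.Computability.Cryptography

namespace ShiftSampling

open _root_.Computability Complexity Complexity.CodeFP Kitaev1995 PeriodFinding Finset

/-! ### The law of the vector of Kitaev's estimates under a product of per-unit laws -/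

section CharVector

variable {U : Type*} [Fintype U] [DecidableEq U] {Ω : Type*} [DecidableEq Ω] {Lv B : ℕ}

omit [Fintype U] [DecidableEq U] in
/-- With a constant block length `L` and one table `T` for all units, the weight of the character `c`
is `corrMass_{2^L}(T)(c) / (2^L)²`. [folklore] -/
theorem unitWeight_const (L : ℕ) (T : ℕ → Ω) (u : U) (c : ℕ) :
    unitWeight (fun _ : U => L) (fun _ => T) u c = corrMass (2 ^ L) T c / ((2 : ℝ) ^ L) ^ 2 := by
  simp only [unitWeight, Qof, Nat.cast_pow, Nat.cast_ofNat]

/-- **All characters at once.** Under the product of the per-unit laws (block length `L`, `Lv` levels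
with `2^L ≤ 2^{Lv−1}`, `B` repetitions), the probability that Kitaev's estimates of all units form the
character vector `c⃗` is at least `(1 − #U·ηacc(Lv, B)) · ∏_u unitWeight_u (c_u)`: the event is a
product event, each factor is `≥ (1 − ηacc) unitWeight_u (c_u)` (`unitLaw_cEst_ge`), and
`(1 − ηacc)^{#U} ≥ 1 − #U·ηacc`. [cite: Kitaev1995, §3 Thm 1; Jozsa2003, §10 Thm. 6] -/
theorem prob_cEstVec_ge (L : ℕ) (F : U → ℕ → Ω) (hB : 0 < B) (hLv : 0 < Lv) (hL : 2 ^ L ≤ 2 ^ (Lv - 1))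
    (cs : U → Fin (2 ^ L)) :
    (1 - Fintype.card U * ηacc Lv B) * ∏ u, unitWeight (fun _ : U => L) F u (cs u) ≤
      prob (X := fun _ : U => TIdx Lv B → Bool) (unitLaw (fun _ : U => L) F)
        (Fintype.piFinset fun u => univ.filter fun γu : TIdx Lv B → Bool => cEst (2 ^ L) γu = cs u) := by
  classical
  rw [prob_piFinset]
  -- per unit: Kitaev's accuracy
  have hu : ∀ u, (1 - ηacc Lv B) * unitWeight (fun _ : U => L) F u (cs u) ≤
      ∑ γu ∈ univ.filter (fun γu : TIdx Lv B → Bool => cEst (2 ^ L) γu = cs u), unitLaw (fun _ : U => L) F u γu :=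
    fun u => unitLaw_cEst_ge (fun _ : U => L) F hB hLv (u := u) hL (cs u)
  have hW : 0 ≤ ∏ u, unitWeight (fun _ : U => L) F u (cs u) := prod_nonneg fun u _ => unitWeight_nonneg _ _ _ _
  have hR : 0 ≤ ∏ u, ∑ γu ∈ univ.filter (fun γu : TIdx Lv B → Bool => cEst (2 ^ L) γu = cs u),
      unitLaw (fun _ : U => L) F u γu :=
    prod_nonneg fun u _ => sum_nonneg fun γu _ => (unitLaw_isProbVec _ _).nonneg u γu
  have hη0 : 0 ≤ ηacc Lv B := by unfold ηacc; positivity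
  by_cases hη1 : ηacc Lv B ≤ 1
  · -- Bernoulli
    have hBer := one_add_mul_le_pow (a := -ηacc Lv B) (by linarith) (Fintype.card U)
    rw [mul_neg, ← sub_eq_add_neg, ← sub_eq_add_neg] at hBer
    calc (1 - Fintype.card U * ηacc Lv B) * ∏ u, unitWeight (fun _ : U => L) F u (cs u)
        ≤ (1 - ηacc Lv B) ^ Fintype.card U * ∏ u, unitWeight (fun _ : U => L) F u (cs u) :=
          mul_le_mul_of_nonneg_right hBer hW
      _ = ∏ u, (1 - ηacc Lv B) * unitWeight (fun _ : U => L) F u (cs u) := by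
          rw [prod_mul_distrib, prod_const, card_univ]
      _ ≤ ∏ u, ∑ γu ∈ univ.filter (fun γu : TIdx Lv B → Bool => cEst (2 ^ L) γu = cs u),
            unitLaw (fun _ : U => L) F u γu :=
          prod_le_prod (fun u _ => mul_nonneg (sub_nonneg.2 hη1) (unitWeight_nonneg _ _ _ _)) fun u _ => hu u
  · -- `ηacc > 1`: the bound is trivial (or there is no unit)
    push Not at hη1
    rcases isEmpty_or_nonempty U with hU | hU
    · simp [univ_eq_empty, Fintype.card_eq_zero]
    · have hc : (1 : ℝ) ≤ Fintype.card U := by exact_mod_cast Fintype.card_pos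
      have hle : ηacc Lv B ≤ Fintype.card U * ηacc Lv B := le_mul_of_one_le_left hη0 hc
      have hneg : 1 - Fintype.card U * ηacc Lv B ≤ 0 := by linarith
      exact (mul_nonpos_of_nonpos_of_nonneg hneg hW).trans hR

/-- **The read character vector lies in `G`** with probability at least
`(1 − #U·ηacc) · ∑_{c⃗ ∈ G} ∏_u unitWeight_u (c_u)`: the fibres of distinct character vectors are
disjoint events. [cite: Kitaev1995, §3 Thm 1; Jozsa2003, §10 Thm. 6] -/
theorem prob_cEstVec_mem_ge (L : ℕ) (F : U → ℕ → Ω) (hB : 0 < B) (hLv : 0 < Lv) (hL : 2 ^ L ≤ 2 ^ (Lv - 1))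
    (G : Finset (U → Fin (2 ^ L))) :
    (1 - Fintype.card U * ηacc Lv B) * ∑ cs ∈ G, ∏ u, unitWeight (fun _ : U => L) F u (cs u) ≤
      prob (X := fun _ : U => TIdx Lv B → Bool) (unitLaw (fun _ : U => L) F)
        (G.biUnion fun cs => Fintype.piFinset fun u =>
          univ.filter fun γu : TIdx Lv B → Bool => cEst (2 ^ L) γu = cs u) := by
  classical
  have hdis : (G : Set (U → Fin (2 ^ L))).PairwiseDisjoint fun cs => Fintype.piFinset fun u =>
      univ.filter fun γu : TIdx Lv B → Bool => cEst (2 ^ L) γu = cs u := by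
    intro cs _ cs' _ hne
    rw [Function.onFun, disjoint_left]
    intro γ h1 h2
    apply hne
    funext u
    apply Fin.ext
    have e1 := (mem_filter.1 (Fintype.mem_piFinset.1 h1 u)).2
    have e2 := (mem_filter.1 (Fintype.mem_piFinset.1 h2 u)).2
    exact e1.symm.trans e2
  have hsum : prob (X := fun _ : U => TIdx Lv B → Bool) (unitLaw (fun _ : U => L) F)
      (G.biUnion fun cs => Fintype.piFinset fun u =>
        univ.filter fun γu : TIdx Lv B → Bool => cEst (2 ^ L) γu = cs u) =
      ∑ cs ∈ G, prob (X := fun _ : U => TIdx Lv B → Bool) (unitLaw (fun _ : U => L) F)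
        (Fintype.piFinset fun u => univ.filter fun γu : TIdx Lv B → Bool => cEst (2 ^ L) γu = cs u) := by
    unfold prob
    rw [sum_biUnion hdis]
  rw [hsum, mul_sum]
  exact sum_le_sum fun cs _ => prob_cEstVec_ge L F hB hLv hL cs

end CharVector

/-! ### The character-vector form of the shift-sampling experiment -/

/-- **The character-vector form of the shift-sampling experiment.** For a parameter bundle `P` with counter
expressions and unary-computable sizes, levels `Lv = L + 1`, and a polynomial-time table program `tab`, the family
`P.family` is oracle-free and uniform, the vector of the `nU` unit characters is read off the measured string in
polynomial time, and for every set `G` of character vectors the probability that the read vector lies in `G` is at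
least `(1 − nU·ηacc(Lv, B)) · ∑_{c⃗ ∈ G} ∏_u corrMass_Q(tab z)(c_u)/Q²` (independent units, Kitaev's per-unit
accuracy). [cite: Kitaev1995, §3 Thm 1; Jozsa2003, §10 Thm. 6] -/
theorem charVector_family :
    ∀ (P : SSParams) (Γ : P.GEParams) (hnU : CodeFP unE unE P.nU) (hL : CodeFP unE unE P.L) (hLv : CodeFP unE unE P.Lv)
      (hB : CodeFP unE unE P.B), (∀ n, P.Lv n = P.L n + 1) →
      ∀ (tab : List Bool → ℕ → List Bool) (htab : CodeFP (pairE strE natE) strE (fun p => tab p.1 p.2)),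
        (P.family (P.blockFn_mem_FP hnU hL hLv hB htab)).IsUniform ∧
        (∃ rd : List Bool → List Bool, rd ∈ FP ∧ ∀ z v : List Bool,
          rd (boolPair z v) = encodingListNatBool.encode ((List.range (P.nU z.length)).map (P.charOf z.length v))) ∧
        ∀ (z : List Bool) (G : Finset (Fin (P.nU z.length) → Fin (2 ^ P.L z.length))),
          (1 - P.nU z.length * ηacc (P.Lv z.length) (P.B z.length)) *
              ∑ cs ∈ G, ∏ u, corrMass (2 ^ P.L z.length) (tab z) ((cs u : ℕ) : ℤ) / ((2 : ℝ) ^ P.L z.length) ^ 2 ≤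
            (P.family (P.blockFn_mem_FP hnU hL hLv hB htab)).kernelProb 0 z
              {v | (fun u : Fin (P.nU z.length) => P.charOf z.length v u) ∈ G.image (fun cs u => ((cs u : ℕ)))} := by
  intro P Γ hnU hL hLv hB hLvL tab htab
  refine ⟨P.family_isUniform (P.blockFn_mem_FP hnU hL hLv hB htab) Γ, ?_, ?_⟩
  · -- the read-out program: `⟨z, v⟩ ↦ [charOf |z| v 0, …, charOf |z| v (nU |z| − 1)]`
    have h1 : CodeFP (pairE (pairE strE strE) natE) unE (fun q => q.1.1.length) := (strLength.comp (fst _ _).fst' :)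
    have h2 : CodeFP (pairE (pairE strE strE) natE) strE (fun q => q.1.2) := (fst _ _).snd'
    have h3 : CodeFP (pairE (pairE strE strE) natE) natE (fun q => q.2) := snd _ _
    have hg : CodeFP (pairE (pairE strE strE) natE) natE (fun q => P.charOf q.1.1.length q.1.2 q.2) :=
      ((P.codeFP_charOf hL hLv hB).comp ((h1.pair h2).pair h3) :)
    have hl : CodeFP (pairE strE strE) (rawE natE) (fun p => List.range (P.nU p.1.length)) :=
      (urange.comp (hnU.comp (strLength.comp (fst _ _))) :)
    have hm : CodeFP (pairE strE strE) (rawE natE)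
        (fun p => (List.range (P.nU p.1.length)).map (P.charOf p.1.length p.2)) :=
      ((CodeFP.map hg).comp ((CodeFP.id _).pair hl) :).congr fun p => rfl
    have hlist : CodeFP (pairE strE strE) (listE natE)
        (fun p => (List.range (P.nU p.1.length)).map (P.charOf p.1.length p.2)) :=
      ((listOfRaw natE).comp hm :).congr fun p => rfl
    have henc : ∀ l : List ℕ, encodingListNatBool.encode l = listE natE l := fun l =>
      congrFun (listE_eq encodingNatBool) l
    obtain ⟨rd, hrd, hrde⟩ := hlist
    refine ⟨rd, hrd, fun z v => ?_⟩
    rw [henc]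
    exact hrde (z, v)
  · -- the law: the success event on read-outs is a disjoint union of product events
    intro z G
    classical
    have hS : {v : List Bool | (fun u : Fin (P.nU z.length) => P.charOf z.length v u) ∈ G.image (fun cs u => ((cs u : ℕ)))} =
        {v : List Bool | P.readOf z.length v ∈ G.biUnion fun cs => Fintype.piFinset fun u =>
          univ.filter fun γu : TIdx (P.Lv z.length) (P.B z.length) → Bool => cEst (2 ^ P.L z.length) γu = cs u} := by
      ext v
      simp only [Set.mem_setOf_eq, mem_image, mem_biUnion, Fintype.mem_piFinset, mem_filter, mem_univ, true_and]
      refine exists_congr fun cs => and_congr_right fun _ => ?_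
      rw [funext_iff]
      exact forall_congr' fun u => by rw [P.charOf_eq]; exact eq_comm
    rw [hS, P.kernelProb_family (P.blockFn_mem_FP hnU hL hLv hB htab) z]
    have hQ : 2 ^ P.L z.length ≤ 2 ^ (P.Lv z.length - 1) := by rw [hLvL, Nat.add_sub_cancel]
    have h := prob_cEstVec_mem_ge (U := Fin (P.nU z.length)) (P.L z.length) (fun _ => tab z) (P.B_pos z.length)
      (P.Lv_pos z.length) hQ G
    rw [Fintype.card_fin] at h
    simp only [unitWeight_const] at h
    exact h

end ShiftSampling

end Literature.Computability.Cryptography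

end
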